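import Summits.BirchSwinnertonDyer.BirchSwinnertonDyer.Theorems.Rank1ResidualJetDefs
import Summits.BirchSwinnertonDyer.BirchSwinnertonDyer.Theorems.Rank1ResidualX9JetchevCha
import Summits.BirchSwinnertonDyer.Rank1Residual.X11b.KolyvaginBottomPoint
import Summits.BirchSwinnertonDyer.Rank1Residual.X11b.Three.KolyvaginLine
import Literature.NumberTheory.EllipticCurves.HeegnerPointsOfConductorOneData
import Literature.NumberTheory.EllipticCurves.HeegnerPointsKolyvaginPrimaryGeneratorProofs
import Literature.NumberTheory.EllipticCurves.Rank1Residual.Typed.KolyvaginCertificate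
import Literature.NumberTheory.EllipticCurves.BSDSelmerCMPConverseHeegnerFieldProofs
import Literature.NumberTheory.EllipticCurves.BSDSelmerPConverseSerreProofs
import Literature.NumberTheory.EllipticCurves.ZywinaCMImageProofs
import HarnessLib

/-!
# T1 JET (cell `bsd-jet`), bucket A (`q ≠ p`): the Tamagawa-sharpened Heegner-index certificate at a
# prime `p ∣ N` through the READING binder `JetchevDivisibilityCarrierNe` — the flag-free twin of
# `bsdp_of_millerJetchev_of_index_le_tamagawa`, PROVED modulo named inputs

HONEST FRAMING (programme file §HONESTY, verbatim): «no tranche here proves BSD; ARM L moves the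
LITERAL column of an r ≤ 1 census into the kernel-proved-modulo-named-print column». THEOREMS ONLY
(seat `bsd-jet-pv-1`, prover; `--supports stmt-BirchSwinnertonDyer-14418`, helper, like its sibling
`Rank1ResidualX9JetchevCha.lean`). Nothing is asserted about any curve; every published input is a
named fact of the tree taken as a binder; the ONE non-published input is the reading binder
`JetchevDivisibilityCarrierNe` (`Rank1ResidualJetDefs.lean`: Jetchev 2008 Thm. 1.4 `m_∞ ≥ ord_p c_q`
at a carrier `q ≠ p`, no hypothesis on the reduction at `p` — the cell's reading «the printed
argument goes through verbatim», audit sheet `HOME/sheets/PV1-A-BLOCK-READING.md`; referee's word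
pending). PARTITION: row D5 `JET@p∣N`, bucket A (171 015 literal classes, census
`HOME/jet_rows.tsv` 29cec7d45121a57c) — types-the-consumer-of; moves 0 classes by itself.

## Why this file

The register books a JET row through `bsdp_of_millerJetchev_of_index_le_tamagawa`
(`Rank1ResidualX9JetchevCha.lean` :86), whose only class-free index input is
`Miller2011.thm54_cha_padicValNat_shaOrder_add_tamagawa_le` (FLAG `Miller11-Thm54-Cha-case`; at
`p ∣ N` also `JET@p∣N`: Jetchev's Hypothesis (∗) has «`p ∤ N`»). This file re-derives the SAME
conclusion `BSDp W p` from the SAME per-row certificate (a Heegner field `K`, a Heegner point `P` of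
infinite order, ONE prime `q ∣ N` with `ord_p [E(K) : ℤP] ≤ ord_p c_q`, `#Ш_an` a `p`-unit,
`r_an ≤ 1`) with `hMJ` REPLACED by: the reading binder `hJ : JetchevDivisibilityCarrierNe` (bucket A:
`q ≠ p`), McCallum 1991 Cor. 5.6 upper form `hMcU` (PUBLISHED, no `p`-vs-`N` hypothesis), Kolyvagin's
finiteness `hKo`, Shimura reciprocity at conductor `1` `hrec`, Darmon 2004 Thm. 3.6 `hD36`, GZK `hGZK`
(all PUBLISHED named facts). Extra per-row binders w.r.t. the Miller form: `d_K ≠ −3, −4` (Gross's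
standing simplification in McCallum's fact), the `p`-adic tower `ρ̄_{E,p^n}` onto (for `p ≥ 5`
DISCHARGED from mod-`p` surjectivity by Serre, §4), `q ≠ p`; dropped: `¬ W.HasCM` and `Irr W p`
(both DERIVED from surjectivity at an odd `p`), `p ∤ d_K`, `p² ∤ N` (no hypothesis on the
reduction at `p` at all: additive `p` included).

## Contents
* §1 `padicValNat_card_sha_primary_add_le_of_carrierNe_of_mcCallum` — frame currency over `K`:
  `ord_p #Ш(E/K)[p^∞] + 2·ord_p c_q ≤ 2·M₀` (`p^{M₀} ∥ y_K`), binder ∘ McCallum (the printed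
  deduction of Cor. 1.5 from Thm. 1.4 and formula (1), p. 812).
* §2 `sha_card_add_tamagawa_le_index_of_carrierNe` — `IsHeegnerPoint` currency over `K`:
  `ord_p #Ш(E/K) + 2·ord_p c_q ≤ 2·ord_p [E(K) : ℤP]` (conductor-`1` datum from Darmon 3.6, bottom
  point = `P` by Shimura reciprocity, `M₀ = ord_p [E(K):ℤP]` by McCallum Lemma 5.1 over Mordell–Weil,
  rank one and finiteness by Kolyvagin, no `p`-torsion by irreducibility).
* §3 `noPTorsion_of_carrierNeCertificate`, `bsdp_of_carrierNeCertificate` — the certificate case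
  `ord_p [E(K):ℤP] ≤ ord_p c_q`: `Ш(E/K)[p^∞] = 0`, hence `Ш(E/ℚ)[p] = 0` (odd `p`, restriction
  injective on `p`-torsion), hence `BSDp W p` at a `p`-unit `#Ш_an` in analytic rank `≤ 1`.
* §4 `bsdp_of_carrierNeCertificate_of_five_le` — `p ≥ 5`: the tower DISCHARGED from `ρ̄_{E,p}`
  onto (Serre), i.e. the row's galrep datum as recorded in the register.
* The register rows' binder shape (a Heegner datum of any stated level `N`, `q ∣ N`; Carayol) and the
  multiplicative-`p` tower discharge are in the sibling `Rank1ResidualJetCarrierNeRows.lean`.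

References: [Jetchev2008] Thm. 1.4, Cor. 1.5 (p. 812), Lemma 4.3, Prop. 4.9, Thm. 6.3;
[McCallumLMS1991] §5 Lemma 5.1 (p. 303), Cor. 5.6 (p. 310); [GrossLMS1991] Thm. 1.3, Prop. 6.2 (1)
(p. 245), §4 (4.1); [Darmon2004] Thm. 3.6–3.7; [Miller2011LMS] Def. 1.1, Thm. 5.4; [Serre1972] §1.11;
[SerreAbelianLadic1968] IV-23 Lemma 3.
-/

noncomputable section

open scoped Classical

open WeierstrassCurve Literature.NumberTheory.EllipticCurves
  Literature.NumberTheory.EllipticCurves.ModularForms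
  Literature.NumberTheory.EllipticCurves.Rank1Residual
  Summit.BirchSwinnertonDyer.Rank1Residual Summit.BirchSwinnertonDyer.Rank1Residual.X11b

namespace Summit.BirchSwinnertonDyer.Rank1Residual.JET

/-! ### §1 Frame currency over `K`: the reading binder ∘ McCallum Cor. 5.6 (upper form) -/

/-- **Cor. 1.5 over `K` at a carrier `q ≠ p`, any reduction at `p` (frame currency).** Under the
union of the binders of `JetchevDivisibilityCarrierNe` (`hJ`, READING — not published at `p ∣ N`) and
`McCallum1991_padicValNat_card_sha_primary_add_le_of_globalDivisibility` (`hMcU`, published): `W/ℚ`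
globally minimal (non-CM is DERIVED: `ρ̄_{E,p}` onto at an odd `p`, Zywina 2015 Prop. 1.14, tree
theorem `not_hasSurjectiveModNGaloisRep_of_hasCM`); `K` imaginary quadratic, Heegner for `N = W.conductorNorm ℤ`,
`d_K ∉ {−3, −4}`; `p ≠ 2` with `ρ̄_{E,p^n}` onto for all `n`; a frame `(Dt, β, ι)` with a conductor-`1`
datum `d₁` whose derived point is `P ∈ E(K)` in `E(K̄)`, `P` of infinite order, `p^{M₀} ∥ P` in
`E(K)`; a prime `q ∣ N`, `q ≠ p`. CONCLUSION: `ord_p #Ш(E/K)[p^∞] + 2·ord_p c_q ≤ 2·M₀` — the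
printed deduction *"One obtains as an immediate consequence of the above theorem and Kolyvagin's
formula"* (p. 812), with Thm. 1.4 supplying global divisibility to depth `t = ord_p c_q`.
CONDITIONAL on `hJ` and `hMcU`. [cite: Jetchev2008, Cor. 1.5 (p. 812)]
[cite: McCallumLMS1991, §5 Cor. 5.6 (p. 310) and Lemma 5.1 (p. 303)] -/
theorem padicValNat_card_sha_primary_add_le_of_carrierNe_of_mcCallum
    (hJ : JetchevDivisibilityCarrierNe)
    (hMcU : McCallum1991_padicValNat_card_sha_primary_add_le_of_globalDivisibility)
    (W : WeierstrassCurve ℚ) [W.IsElliptic] [W.IsGloballyMinimal] [NeZero (W.conductorNorm ℤ)]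
    (K : Type) [Field K] [NumberField K] (hK : IsImaginaryQuadratic K)
    (hD3 : NumberField.discr K ≠ -3) (hD4 : NumberField.discr K ≠ -4)
    (hH : SatisfiesHeegnerHypothesis (W.conductorNorm ℤ) K)
    (p : ℕ) [Fact p.Prime] (hp2 : p ≠ 2)
    (htower : ∀ n : ℕ, W.HasSurjectiveModNGaloisRep (p ^ n : ℕ))
    (Dt : ModularParametrizationData W (W.conductorNorm ℤ)) (β : ℤ) (ι : K →+* ℂ)
    (d₁ : KolyvaginHeegnerData Dt β ι 1) (P : (W.baseChange K).toAffine.Point)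
    (hPd : d₁.toGeomPoints d₁.derivedPoint = toGeomPoints (W.baseChange K) P)
    (hnt : ¬ IsOfFinAddOrder P) (M₀ : ℕ)
    (hdiv : ∃ Q : (W.baseChange K).toAffine.Point, ((p ^ M₀ : ℕ) : ℤ) • Q = P)
    (hndiv : ¬ ∃ Q : (W.baseChange K).toAffine.Point, ((p ^ (M₀ + 1) : ℕ) : ℤ) • Q = P)
    (q : ℕ) [Fact q.Prime] (hq : q ∣ W.conductorNorm ℤ) (hqp : q ≠ p) :
    padicValNat p (Nat.card (AddCommGroup.primaryComponent (W.baseChange K).sha p)) +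
        2 * padicValNat p ((W.baseChange ℚ_[q]).localTamagawaNumber ℤ_[q]) ≤ 2 * M₀ := by
  -- no CM: `ρ̄_{E,p}` onto at an odd prime (Zywina 2015 Prop. 1.14/1.16; Serre 1972 §4.5)
  have hsurj : W.HasSurjectiveModNGaloisRep (p : ℤ) := by simpa using htower 1
  have hcm : ¬ W.HasCM := fun hCM ↦
    W.not_hasSurjectiveModNGaloisRep_of_hasCM hCM (Fact.out : p.Prime) hp2 (by simpa using hsurj)
  -- `P_1` has infinite order since `P` has (same image in `E(K̄)`, injective maps)
  have hy₁ : ¬ IsOfFinAddOrder d₁.derivedPoint := by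
    intro hfin
    apply hnt
    have h1 : IsOfFinAddOrder (d₁.toGeomPoints d₁.derivedPoint) :=
      d₁.toGeomPoints.isOfFinAddOrder hfin
    rw [hPd] at h1
    exact (toGeomPoints_injective (W.baseChange K)).isOfFinAddOrder_iff.mp h1
  exact hMcU W hcm K hK hD3 hD4 hH p hp2 htower Dt β ι d₁ P hPd hnt M₀ hdiv hndiv
    (padicValNat p ((W.baseChange ℚ_[q]).localTamagawaNumber ℤ_[q]))
    (fun s hs n d hn hℓ ↦ hJ W hcm K hK hD3 hD4 hH p hp2 htower Dt β ι d₁ hy₁ q hq hqp s hs n d hn hℓ)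

/-! ### §2 `IsHeegnerPoint` currency over `K`: the sharpened index bound for the row's Heegner point -/

/-- **The Tamagawa-sharpened Kolyvagin bound over `K` at a carrier `q ≠ p`, for the Heegner point of a
register row.** For `W/ℚ` globally minimal, an odd prime `p` with `ρ̄_{E,p^n}` onto for all `n`
(`E[p]` irreducible and non-CM follow), `K` imaginary quadratic Heegner for `N = W.conductorNorm ℤ` with
`d_K ∉ {−3, −4}`, a Heegner point `P ∈ E(K)` (`IsHeegnerPoint`) of infinite order and a prime `q ∣ N`,
`q ≠ p`: `ord_p #Ш(E/K) + 2·ord_p c_q ≤ 2·ord_p [E(K) : ℤP]`. PUBLISHED inputs: Kolyvagin (`hKo`: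
rank one, `Ш(E/K)` finite), Shimura reciprocity at conductor `1` (`hrec`: `P_1 = y_K`), Darmon 2004
Thm. 3.6 (`hD36`: the conductor-`1` datum exists), McCallum Cor. 5.6 upper form (`hMcU`); READING
input `hJ`. Steps: a frame `(Dt, H, ι)` of `P`; a conductor-`1` datum `d₁` on `(Dt, H.β, ι)` with bottom
point `P` in `E(K̄)`; `p^{M₀} ∥ P` (Mordell–Weil); §1; `ord_p #Ш = ord_p #Ш[p^∞]` (finite `Ш`);
`ord_p [E(K):ℤP] = M₀` (McCallum Lemma 5.1: rank one, no `p`-torsion in `E(K)` by irreducibility).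
CONDITIONAL on every binder. [cite: Jetchev2008, Cor. 1.5 (p. 812)]
[cite: McCallumLMS1991, §5 Lemma 5.1 (p. 303) and Cor. 5.6 (p. 310)]
[cite: GrossLMS1991, Thm. 1.3 and §4 (4.1)] [cite: Darmon2004, Thm. 3.6–3.7 (PDF pp. 43–44)] -/
theorem sha_card_add_tamagawa_le_index_of_carrierNe
    (hJ : JetchevDivisibilityCarrierNe)
    (hMcU : McCallum1991_padicValNat_card_sha_primary_add_le_of_globalDivisibility)
    (W : WeierstrassCurve ℚ) [W.IsElliptic] [W.IsGloballyMinimal] [NeZero (W.conductorNorm ℤ)]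
    (K : Type) [Field K] [NumberField K]
    (hKo : kolyvagin (W.conductorNorm ℤ) W K)
    (hrec : heegnerPointOfConductor_one_galoisConj (W.conductorNorm ℤ) W K)
    (hD36 : phi_heegnerTau_mem_singularModuliField (W.conductorNorm ℤ) W K)
    (hK : IsImaginaryQuadratic K)
    (hD3 : NumberField.discr K ≠ -3) (hD4 : NumberField.discr K ≠ -4)
    (hH : SatisfiesHeegnerHypothesis (W.conductorNorm ℤ) K)
    (p : ℕ) [Fact p.Prime] (hp2 : p ≠ 2)
    (htower : ∀ n : ℕ, W.HasSurjectiveModNGaloisRep (p ^ n : ℕ))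
    {P : (W.baseChange K).toAffine.Point} (hP : IsHeegnerPoint (W.conductorNorm ℤ) W K P)
    (hnt : ¬ IsOfFinAddOrder P)
    (q : ℕ) [Fact q.Prime] (hq : q ∣ W.conductorNorm ℤ) (hqp : q ≠ p) :
    padicValNat p (Nat.card (W.baseChange K).sha) +
        2 * padicValNat p ((W.baseChange ℚ_[q]).localTamagawaNumber ℤ_[q]) ≤
      2 * padicValNat p (AddSubgroup.zmultiples P).index := by
  have hp : p.Prime := Fact.out
  -- rank one and finiteness of `Ш(E/K)` (Kolyvagin)
  obtain ⟨hrank, hfin⟩ := hKo hK hH hP hnt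
  haveI : Finite (W.baseChange K).sha := hfin
  -- a frame of `P` and a conductor-1 datum on it (Darmon 3.6), with bottom point `P` (Shimura)
  obtain ⟨Dt, H, ι, hPc⟩ := hP
  obtain ⟨d₁⟩ := exists_kolyvaginHeegnerData_one hD36 hK Dt H.β ι H.dvd_sq_sub
  have hPd : d₁.toGeomPoints d₁.derivedPoint = toGeomPoints (W.baseChange K) P :=
    KolyvaginBottom.toGeomPoints_derivedPoint_one_eq hrec hK hH hPc d₁ rfl
  -- the exponent `p^{M₀} ∥ P` (Mordell–Weil)
  haveI : Module.Finite ℤ (W.baseChange K).toAffine.Point := (W.baseChange K).module_finite_point_holds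
  obtain ⟨M₀, x₀, hx₀, hmax⟩ := exists_pow_smul_eq_and_forall_ne hnt (p := p) hp.two_le
  have hdiv : ∃ Q : (W.baseChange K).toAffine.Point, ((p ^ M₀ : ℕ) : ℤ) • Q = P :=
    ⟨x₀, by rw [natCast_zsmul]; exact hx₀⟩
  have hndiv : ¬ ∃ Q : (W.baseChange K).toAffine.Point, ((p ^ (M₀ + 1) : ℕ) : ℤ) • Q = P := by
    rintro ⟨Q, hQ⟩
    exact hmax Q (by rw [← natCast_zsmul]; exact hQ)
  -- §1
  have hle := padicValNat_card_sha_primary_add_le_of_carrierNe_of_mcCallum hJ hMcU W K hK hD3 hD4 hH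
    p hp2 htower Dt H.β ι d₁ P hPd hnt M₀ hdiv hndiv q hq hqp
  -- `ord_p #Ш = ord_p #Ш[p^∞]`
  have hsha : padicValNat p (Nat.card (AddCommGroup.primaryComponent (W.baseChange K).sha p)) =
      padicValNat p (Nat.card (W.baseChange K).sha) :=
    padicValNat_card_addPrimaryComponent (A := (W.baseChange K).sha) p
  -- no `p`-torsion in `E(K)`: `E[p]` irreducible (from surjectivity mod `p`), `K` quadratic
  have hsurj : W.HasSurjectiveModNGaloisRep (p : ℤ) := by simpa using htower 1
  haveI : NeZero (p : ℚ) := ⟨Nat.cast_ne_zero.mpr hp.ne_zero⟩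
  have hirr : W.HasIrreducibleModPGaloisRep p :=
    hasIrreducibleModPGaloisRep_of_hasSurjectiveModNGaloisRep W p hsurj
  have hbot := torsionBy_eq_bot_of_isImaginaryQuadratic_of_hasIrreducibleModPGaloisRep W K hK hp hirr
  have hiv : ∀ x : (W.baseChange K).toAffine.Point, p • x = 0 → x = 0 := fun x hx ↦ by
    have hmem : x ∈ AddSubgroup.torsionBy (W.baseChange K).toAffine.Point ((p : ℕ) : ℤ) := by
      rw [mem_torsionBy_iff, natCast_zsmul]
      exact hx
    rw [hbot] at hmem
    exact hmem
  -- `ord_p [E(K):ℤP] = M₀` (McCallum Lemma 5.1 over Mordell–Weil)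
  haveI : Finite (AddCommGroup.torsion (W.baseChange K).toAffine.Point) :=
    WeierstrassCurve.finite_torsion_point (W := W.baseChange K)
  obtain ⟨c, Q, hcQ, hcker⟩ := RankOne.exists_coord_of_mordellWeilRank_eq_one (W.baseChange K) hrank
  have hidx : padicValNat p (AddSubgroup.zmultiples P).index = M₀ :=
    Three.Koly.padicValNat_index_zmultiples_eq_of_divisibility c Q hcQ hcker hiv P hdiv hndiv
  rw [hidx, ← hsha]
  exact hle

/-! ### §3 The certificate case: `Ш(E/ℚ)[p] = 0` and `BSD(E,p)` -/

/-- **The bucket-A certificate gives `Ш(E/ℚ)[p] = 0`.** For `W/ℚ` globally minimal, an odd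
prime `p` with `ρ̄_{E,p^n}` onto for all `n`, an imaginary quadratic `K` (Heegner for
`N = W.conductorNorm ℤ`, `d_K ∉ {−3, −4}`), a Heegner point `P ∈ E(K)` of infinite order and ONE prime
`q ∣ N`, `q ≠ p`, with `ord_p [E(K) : ℤP] ≤ ord_p c_q(E)`: §2 forces `ord_p #Ш(E/K) = 0`; `Ш(E/K)`
is finite (Kolyvagin), so `p ∤ #Ш(E/K)`, and restriction `Ш(E/ℚ) → Ш(E/K)` is injective on
`Ш(E/ℚ)[p]` (`p` odd, `[K:ℚ] = 2`; `injOn_shaRestriction_torsionBy`). NO hypothesis on the reduction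
of `E` at `p`. CONDITIONAL on the reading binder `hJ` and the published `hMcU`, `hKo`, `hrec`, `hD36`.
Per curve; nothing booked here. [cite: Jetchev2008, Cor. 1.5 (p. 812)] [cite: GrossLMS1991, Thm. 1.3]
[cite: McCallumLMS1991, §5 Cor. 5.6 (p. 310)] -/
theorem noPTorsion_of_carrierNeCertificate
    (hJ : JetchevDivisibilityCarrierNe)
    (hMcU : McCallum1991_padicValNat_card_sha_primary_add_le_of_globalDivisibility)
    (W : WeierstrassCurve ℚ) [W.IsElliptic] [W.IsGloballyMinimal] [NeZero (W.conductorNorm ℤ)]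
    (K : Type) [Field K] [NumberField K]
    (hKo : kolyvagin (W.conductorNorm ℤ) W K)
    (hrec : heegnerPointOfConductor_one_galoisConj (W.conductorNorm ℤ) W K)
    (hD36 : phi_heegnerTau_mem_singularModuliField (W.conductorNorm ℤ) W K)
    (hK : IsImaginaryQuadratic K)
    (hD3 : NumberField.discr K ≠ -3) (hD4 : NumberField.discr K ≠ -4)
    (hH : SatisfiesHeegnerHypothesis (W.conductorNorm ℤ) K)
    (p : ℕ) [Fact p.Prime] (hp2 : p ≠ 2)
    (htower : ∀ n : ℕ, W.HasSurjectiveModNGaloisRep (p ^ n : ℕ))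
    {P : (W.baseChange K).toAffine.Point} (hP : IsHeegnerPoint (W.conductorNorm ℤ) W K P)
    (hnt : ¬ IsOfFinAddOrder P)
    (q : ℕ) [Fact q.Prime] (hq : q ∣ W.conductorNorm ℤ) (hqp : q ≠ p)
    (hI : padicValNat p (AddSubgroup.zmultiples P).index ≤
      padicValNat p ((W.baseChange ℚ_[q]).localTamagawaNumber ℤ_[q])) :
    ∀ x : W.sha, (p : ℤ) • x = 0 → x = 0 := by
  have hpp : p.Prime := Fact.out
  obtain ⟨-, hfinK⟩ := hKo hK hH hP hnt
  haveI : Finite (W.baseChange K).sha := hfinK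
  have hb := sha_card_add_tamagawa_le_index_of_carrierNe hJ hMcU W K hKo hrec hD36 hK hD3 hD4 hH p
    hp2 htower hP hnt q hq hqp
  have h0 : padicValNat p (Nat.card (W.baseChange K).sha) = 0 := by omega
  have hndvd : ¬ p ∣ Nat.card (W.baseChange K).sha := by
    rcases padicValNat.eq_zero_iff.mp h0 with h1 | h0' | hnd
    · exact absurd h1 hpp.one_lt.ne'
    · exact absurd h0' Nat.card_pos.ne'
    · exact hnd
  haveI : IsGalois ℚ K := by
    haveI : Algebra.IsQuadraticExtension ℚ K := ⟨hK.1⟩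
    infer_instance
  have hcop : p.Coprime (Module.finrank ℚ K) := by
    rw [hK.1]
    exact (Nat.coprime_primes hpp Nat.prime_two).mpr hp2
  intro x hx
  have hxn : p • x = 0 := by rw [← natCast_zsmul]; exact hx
  have hres : shaRestriction W K x = 0 := by
    have hpr : p • shaRestriction W K x = 0 := by rw [← map_nsmul, hxn, map_zero]
    have hdv : addOrderOf (shaRestriction W K x) ∣ p := addOrderOf_dvd_of_nsmul_eq_zero hpr
    rcases (Nat.dvd_prime hpp).mp hdv with h1 | hp'
    · exact AddMonoid.addOrderOf_eq_one_iff.mp h1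
    · exact absurd (hp' ▸ addOrderOf_dvd_natCard (shaRestriction W K x)) hndvd
  have hx_mem : x ∈ (AddSubgroup.torsionBy W.sha p : Set W.sha) :=
    AddSubgroup.torsionBy.nsmul_iff.mpr hxn
  have h0_mem : (0 : W.sha) ∈ (AddSubgroup.torsionBy W.sha p : Set W.sha) :=
    AddSubgroup.torsionBy.nsmul_iff.mpr (smul_zero _)
  exact injOn_shaRestriction_torsionBy W K hcop hx_mem h0_mem (by rw [hres, map_zero])

/-- **`BSD(E,p)` from the bucket-A certificate at a pair with `p ∤ #Ш_an` — the flag-free twin of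
`bsdp_of_millerJetchev_of_index_le_tamagawa`.** Analytic rank `≤ 1`; per-row data: `K` imaginary
quadratic (Heegner hypothesis for `N = W.conductorNorm ℤ`, `d_K ∉ {−3, −4}`), a Heegner point `P` of
infinite order, ONE prime `q ∣ N` with `q ≠ p` and `ord_p [E(K) : ℤP] ≤ ord_p c_q`, `p` odd with
`ρ̄_{E,p^n}` onto for all `n` (non-CM and `E[p]` irreducible follow), `#Ш_an = s` with `ord_p s = 0`; NO hypothesis on the
reduction of `E` at `p` (multiplicative and additive `p ∣ N` alike). Class-free binders: the READING
`hJ : JetchevDivisibilityCarrierNe` and the PUBLISHED `hMcU` (McCallum Cor. 5.6), `hKo` (Kolyvagin),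
`hrec` (Shimura reciprocity, conductor `1`), `hD36` (Darmon Thm. 3.6), `hGZK` (bsd.S17). Per curve; not
a class theorem; whether a row books through it is referee A's word on the reading.
[cite: Jetchev2008, Cor. 1.5 (p. 812)] [cite: Miller2011LMS, Thm. 5.4 and Def. 1.1]
[cite: McCallumLMS1991, §5 Cor. 5.6 (p. 310)] -/
theorem bsdp_of_carrierNeCertificate
    (hJ : JetchevDivisibilityCarrierNe)
    (hMcU : McCallum1991_padicValNat_card_sha_primary_add_le_of_globalDivisibility)
    (hGZK : rank_eq_analyticRank_of_analyticRank_le_one)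
    (W : WeierstrassCurve ℚ) [W.IsElliptic] [W.IsGloballyMinimal] [NeZero (W.conductorNorm ℤ)]
    (K : Type) [Field K] [NumberField K]
    (hKo : kolyvagin (W.conductorNorm ℤ) W K)
    (hrec : heegnerPointOfConductor_one_galoisConj (W.conductorNorm ℤ) W K)
    (hD36 : phi_heegnerTau_mem_singularModuliField (W.conductorNorm ℤ) W K)
    (hK : IsImaginaryQuadratic K)
    (hD3 : NumberField.discr K ≠ -3) (hD4 : NumberField.discr K ≠ -4)
    (hH : SatisfiesHeegnerHypothesis (W.conductorNorm ℤ) K)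
    (p : ℕ) [Fact p.Prime] (hp2 : p ≠ 2)
    (htower : ∀ n : ℕ, W.HasSurjectiveModNGaloisRep (p ^ n : ℕ))
    {P : (W.baseChange K).toAffine.Point} (hP : IsHeegnerPoint (W.conductorNorm ℤ) W K P)
    (hnt : ¬ IsOfFinAddOrder P)
    (q : ℕ) [Fact q.Prime] (hq : q ∣ W.conductorNorm ℤ) (hqp : q ≠ p)
    (hI : padicValNat p (AddSubgroup.zmultiples P).index ≤
      padicValNat p ((W.baseChange ℚ_[q]).localTamagawaNumber ℤ_[q]))
    (hr : W.analyticRank ≤ 1) {s : ℚ} (hs : shaAn W = (s : ℂ)) (hv : padicValRat p s = 0) :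
    BSDp W p :=
  Typed.bsdp_of_shaAn_unit_of_noPTorsion W p hGZK hr hs hv
    (noPTorsion_of_carrierNeCertificate hJ hMcU W K hKo hrec hD36 hK hD3 hD4 hH p hp2 htower hP
      hnt q hq hqp hI)

/-! ### §4 `p ≥ 5`: the tower and non-CM discharged from mod-`p` surjectivity (Serre) -/

/-- **`BSD(E,p)` from the bucket-A certificate, `p ≥ 5`, with the register's galrep datum
`ρ̄_{E,p}` onto as the only image input**: the `p`-adic tower follows by Serre's lifting lemma
(`serre_hasSurjectiveModNGaloisRep_pow_holds`, Serre 1968 IV-23). Otherwise as `bsdp_of_carrierNeCertificate`.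
CONDITIONAL on the reading binder `hJ` and the published binders. [cite: Jetchev2008, Cor. 1.5 (p. 812)]
[cite: SerreAbelianLadic1968, Ch. IV §3.4 Lemma 3 (IV-23)] [cite: Miller2011LMS, Def. 1.1] -/
theorem bsdp_of_carrierNeCertificate_of_five_le
    (hJ : JetchevDivisibilityCarrierNe)
    (hMcU : McCallum1991_padicValNat_card_sha_primary_add_le_of_globalDivisibility)
    (hGZK : rank_eq_analyticRank_of_analyticRank_le_one)
    (W : WeierstrassCurve ℚ) [W.IsElliptic] [W.IsGloballyMinimal] [NeZero (W.conductorNorm ℤ)]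
    (K : Type) [Field K] [NumberField K]
    (hKo : kolyvagin (W.conductorNorm ℤ) W K)
    (hrec : heegnerPointOfConductor_one_galoisConj (W.conductorNorm ℤ) W K)
    (hD36 : phi_heegnerTau_mem_singularModuliField (W.conductorNorm ℤ) W K)
    (hK : IsImaginaryQuadratic K)
    (hD3 : NumberField.discr K ≠ -3) (hD4 : NumberField.discr K ≠ -4)
    (hH : SatisfiesHeegnerHypothesis (W.conductorNorm ℤ) K)
    (p : ℕ) [Fact p.Prime] (h5 : 5 ≤ p) (hsurj : W.HasSurjectiveModNGaloisRep p)
    {P : (W.baseChange K).toAffine.Point} (hP : IsHeegnerPoint (W.conductorNorm ℤ) W K P)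
    (hnt : ¬ IsOfFinAddOrder P)
    (q : ℕ) [Fact q.Prime] (hq : q ∣ W.conductorNorm ℤ) (hqp : q ≠ p)
    (hI : padicValNat p (AddSubgroup.zmultiples P).index ≤
      padicValNat p ((W.baseChange ℚ_[q]).localTamagawaNumber ℤ_[q]))
    (hr : W.analyticRank ≤ 1) {s : ℚ} (hs : shaAn W = (s : ℂ)) (hv : padicValRat p s = 0) :
    BSDp W p := by
  have hp2 : p ≠ 2 := by omega
  have htower : ∀ n : ℕ, W.HasSurjectiveModNGaloisRep (p ^ n : ℕ) :=
    serre_hasSurjectiveModNGaloisRep_pow_holds W p h5 hsurj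
  exact bsdp_of_carrierNeCertificate hJ hMcU hGZK W K hKo hrec hD36 hK hD3 hD4 hH p hp2 htower hP
    hnt q hq hqp hI hr hs hv

end Summit.BirchSwinnertonDyer.Rank1Residual.JET

end
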